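import Literature.MathematicalPhysics.QuantumFieldTheory.Balaban1983to89.Node00.Record13NumericsOfThm1CCM

/-!
# NODE 00 (YM-PLAN Track A) — STAGE 13: THE LETTERS OF THE GAUGE ROAD (Cut B‴) AT THE COLLARED WITNESS `θ₁₅ᶜᶜᴹ(j) = theta13OfThm1CCM F N j ε₀ ε₂₉ B₃ B₃' a₀ a₁`,
# THE PINS `hM`∕`hM₁`, ★ THE COLLAR LETTER `(11·4 + 3·L)·L ≤ ν.M₁`, ★ NO WRAPPING UNDER `j + 1 ≤ F.m` AND ★ THE KERNEL CERTIFICATE THAT THE TOP [I]-CUBE WRAPS WHEN `F.m ≤ j`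
# (plan g75 LOCATED (δ)), and the two history clauses from the β-box

Cell `pub-ymgap`, seat `pub-ymgap-dag-n21-c` (g11), dag-lead WORDS-144 pen (γ) «THE WITNESS RE-PIN».  FILE A2 of two (A1 = `Node00/Record13NumericsOfThm1CCM`: the numerics, the
witness, its `rfl` views and faces).  NEW leaf, theorems only; node00-def-K0a's FILES 13a∕13b (`Record13SepBgRowOfClassC1`), 13e (`Record13MonotoneHistoryOfBetaSign`), 14d
(`Record13ReverseComparabilityOfBetaBox`) and 21 (`Record13SepCoPInhabitedOfThm1CoPGauge`) CONSUMED BY NAME (their θ-generic lemmas instantiated; their at-`θ₁₅ᶜᶜ¹` one-liners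
re-derived at `θ₁₅ᶜᶜᴹ`), nothing modified.  `--supports stmt-QuantumFields-20541`.
[15] = [Balaban1985Variational], [6] = [Balaban1985RegularSpaces], [III] = [Balaban1988Convergent], [I] = [Balaban1987RG1], [IV] = [Balaban1989LargeFieldI].

WHAT THIS FILE PROVES (theorems only; 0 `def`).
* §3 every letter of FILE 21 §2's binder list at the collared witness, along every windowed run: `hnum_`, `εreg_le_`, `hε0_`, `hg_`, `hpq_`, `hα0_`, `hBα_`, `hC1_`,
  `hcomp_…_of_monotone`, `mul_A0_nonneg_∕mul_A0_le_C₀_thm1CCM`, `gauge_mul_A0_nonneg_∕_le_cB_C₀_∕_le_BCM_C₀_thm1CCM`, `htI_`, `htMS_` (the numerics they read are the unit branch's: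
  `A₀ᶜᶜ¹`, `p₀ = 1`, `cR = 1`, `cB = 6L + 1`, `B·C·M_r = 7`, `C₀ = 1`, `γ = ½`).
* §4 the pins `τ9_M_pos_`, `M₁_pos_`, `hM_theta13OfThm1CCM : ∃ a, τ9.M = F.L ^ a` (`⟨j, rfl⟩`), `hM₁_theta13OfThm1CCM : ν.M₁ ∣ τ9.M` (`dvd_refl`); ★ THE COLLAR LETTER
  `collar_le_M₁_theta13OfThm1CCM (hj : 3 ≤ j) : (11·4 + 3·F.L)·F.L ≤ ν.M₁` (and its `(F.P K)`-letter form); ★ NO WRAPPING `hsN_theta13OfThm1CCM (hjm : j + 1 ≤ F.m)` (cubes of side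
  `L^{n'}·L^j`, `n' ≤ K + 1`, are shorter than the torus `2L^{m+K}`); ★ THE CERTIFICATE OF (δ) `exists_wrap_theta13OfThm1CCM_of_le (hmj : F.m ≤ j)`: on EVERY run the top [I]-cube
  (`n' = K + 1`, side `L^{K+1+j} ≥ 2·L^{m+K}`) is at least as long as the torus, `not_hsN_theta13OfThm1CCM_of_le`, and ★ `hsN_theta13OfThm1CCM_iff : (hsN at p) ↔ j + 1 ≤ F.m` — the
  non-wrapping binder of the row body holds at this member EXACTLY for families with `j + 1 ≤ F.m` (with the collar floor `j ≥ 3`: `F.m ≥ 4`; `T4Family.hm` gives `1 ≤ m` only;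
  director's ruling on (δ) pending — displayed, not hidden: every closer on this member carries `(hjm : j + 1 ≤ F.m)`).
* §5 the two history clauses at the witness from the β-box on `]0, ½]` (13e ∕ 14d, θ-generic): `hmono_`, `hcomp_…_of_betaLowerH`, `hcompRev_…_of_betaBox`, `hcompBoth_…`.

HONEST FRAMING.  One-line instantiations + elementary arithmetic (`L^{K+1+j} < 2L^{m+K} ⟺ j + 1 ≤ m`); nothing of Bałaban asserted; NOT a discharge; K0⁷ NOT closed (stubs: [15]
Prop. 8 top step, [6] Prop. 6 member sockets, the β-box); counts unmoved (typed 28∕28 · discharged 5∕27); one finite 𝕋⁴ programme at fixed ε — NOT continuum ∕ OS ∕ mass gap ∕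
Clay.  No `sorry`, no `axiom`, no `def`, no `instance`, no `notation`.
-/

noncomputable section

open MeasureTheory
open scoped Matrix.Norms.L2Operator

namespace Literature.MathematicalPhysics.QuantumFieldTheory.Balaban1983to89.Node00

open T4Continuum B14.Eq218Concrete B15DeterminingSets B12RegularSpaces111 B14RegularSpaces234 FlowStep FlowStepRuns

/-! ## §3. The letters of the GAUGE road (Cut B‴) at `θ₁₅ᶜᶜᴹ`, along every windowed run -/

section Faces

variable {F : T4Family} {N : ℕ} [NeZero N] {j : ℕ} {ε₀ ε₂₉ B₃ B₃' a₀ a₁ : ℝ}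

/-- **(hnum) AT `θ₁₅ᶜᶜᴹ`**: `0 < cR·ε_m ≤ a₁`, `B₃·cR·ε_m ≤ εreg = a₀` along every windowed run (13a's window lemma; the thresholds are `M₁`-blind).
[cite: Balaban1988Convergent, (2.4) p.255, (2.12) p.256; Balaban1985Variational, Thm 1 (7)–(8) p.279] -/
theorem hnum_theta13OfThm1CCM (hB : 0 ≤ B₃) (hB' : 0 ≤ B₃') (ha₀ : 0 < a₀) (ha₁ : 0 < a₁) :
     ∀ (p : B12.RunParams) (n : ℕ), n ≤ p.K → Step.InInterval (theta13OfThm1CCM F N j ε₀ ε₂₉ B₃ B₃' a₀ a₁).γ n (gOfRecord₁₃ F N (theta13OfThm1CCM F N j ε₀ ε₂₉ B₃ B₃' a₀ a₁) p) → ∀ m, m ≤ n →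
      0 < (theta13OfThm1CCM F N j ε₀ ε₂₉ B₃ B₃' a₀ a₁).s2.cR * epsOfRecord (theta13OfThm1CCM F N j ε₀ ε₂₉ B₃ B₃' a₀ a₁).ν (gOfRecord₁₃ F N (theta13OfThm1CCM F N j ε₀ ε₂₉ B₃ B₃' a₀ a₁) p) m ∧ (theta13OfThm1CCM F N j ε₀ ε₂₉ B₃ B₃' a₀ a₁).s2.cR * epsOfRecord (theta13OfThm1CCM F N j ε₀ ε₂₉ B₃ B₃' a₀ a₁).ν (gOfRecord₁₃ F N (theta13OfThm1CCM F N j ε₀ ε₂₉ B₃ B₃' a₀ a₁) p) m ≤ a₁ ∧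
        B₃ * ((theta13OfThm1CCM F N j ε₀ ε₂₉ B₃ B₃' a₀ a₁).s2.cR * epsOfRecord (theta13OfThm1CCM F N j ε₀ ε₂₉ B₃ B₃' a₀ a₁).ν (gOfRecord₁₃ F N (theta13OfThm1CCM F N j ε₀ ε₂₉ B₃ B₃' a₀ a₁) p) m) ≤ (theta13OfThm1CCM F N j ε₀ ε₂₉ B₃ B₃' a₀ a₁).ν.εreg :=
  fun _ _ _ hw => numerics_thm1CC1_of_inInterval (L := F.L) (ε₀ := ε₀) hB hB' ha₀ ha₁ (by norm_num : (1 / 2 : ℝ) < 1) hw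

/-- `θ₁₅ᶜᶜᴹ.ν.εreg ≤ a₀` (it IS `a₀`). [cite: Balaban1985Variational, Thm 1 (8) p.279 (bookkeeping)] -/
theorem εreg_le_theta13OfThm1CCM : (theta13OfThm1CCM F N j ε₀ ε₂₉ B₃ B₃' a₀ a₁).ν.εreg ≤ a₀ := (theta13OfThm1CCM_εreg F N j ε₀ ε₂₉ B₃ B₃' a₀ a₁).le

/-- **`0 ≤ cR·ε_m` AT `θ₁₅ᶜᶜᴹ`** along every windowed run. [cite: Balaban1988Convergent, (2.4) p.255, (2.10) p.256 (bookkeeping)] -/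
theorem hε0_theta13OfThm1CCM (hB : 0 ≤ B₃) (hB' : 0 ≤ B₃') (ha₀ : 0 < a₀) (ha₁ : 0 < a₁) :
     ∀ (p : B12.RunParams) (n : ℕ), n ≤ p.K → Step.InInterval (theta13OfThm1CCM F N j ε₀ ε₂₉ B₃ B₃' a₀ a₁).γ n (gOfRecord₁₃ F N (theta13OfThm1CCM F N j ε₀ ε₂₉ B₃ B₃' a₀ a₁) p) → ∀ m, m ≤ n → 0 ≤ (theta13OfThm1CCM F N j ε₀ ε₂₉ B₃ B₃' a₀ a₁).s2.cR * epsOfRecord (theta13OfThm1CCM F N j ε₀ ε₂₉ B₃ B₃' a₀ a₁).ν (gOfRecord₁₃ F N (theta13OfThm1CCM F N j ε₀ ε₂₉ B₃ B₃' a₀ a₁) p) m :=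
  fun p n hn hw m hm => (hnum_theta13OfThm1CCM hB hB' ha₀ ha₁ p n hn hw m hm).1.le

/-- **THE WINDOW LETTERS AT `θ₁₅ᶜᶜᴹ`**: `0 < g_m`, `g_m² ≤ e⁻¹` along every windowed run (`γ = ½`). [cite: Balaban1987RG1, Thm 1 p.259; Balaban1988Convergent, (2.4) p.255 (bookkeeping)] -/
theorem hg_theta13OfThm1CCM :
     ∀ (p : B12.RunParams) (n : ℕ), n ≤ p.K → Step.InInterval (theta13OfThm1CCM F N j ε₀ ε₂₉ B₃ B₃' a₀ a₁).γ n (gOfRecord₁₃ F N (theta13OfThm1CCM F N j ε₀ ε₂₉ B₃ B₃' a₀ a₁) p) → ∀ m, m ≤ n → 0 < gOfRecord₁₃ F N (theta13OfThm1CCM F N j ε₀ ε₂₉ B₃ B₃' a₀ a₁) p m ∧ gOfRecord₁₃ F N (theta13OfThm1CCM F N j ε₀ ε₂₉ B₃ B₃' a₀ a₁) p m ^ 2 ≤ Real.exp (-1) :=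
  fun _ _ _ hw => window_sq_le_of_inInterval (theta13OfThm1CCM_γ F N j ε₀ ε₂₉ B₃ B₃' a₀ a₁).le hw

/-- **`p₀ ≤ q₀` AT `θ₁₅ᶜᶜᴹ`** (`1 ≤ 2`). [cite: Balaban1988Convergent, (2.4) p.255, (2.28) p.259 (bookkeeping)] -/
theorem hpq_theta13OfThm1CCM : (theta13OfThm1CCM F N j ε₀ ε₂₉ B₃ B₃' a₀ a₁).ν.p₀ ≤ (lfOfRecord₁₂ F N (theta13OfThm1CCM F N j ε₀ ε₂₉ B₃ B₃' a₀ a₁).toStage12Params).q₀ := by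
  rw [theta13OfThm1CCM_p₀, lfOfRecord₁₂_theta13OfThm1CCM]; norm_num [lfConstsOfFamily, lfConstsOfRecord₁₂]

/-- **`α₀(g_m) > 0` AT `θ₁₅ᶜᶜᴹ`** along every windowed run (`C₀ = 1 > 0`, `0 < g_m ≤ ½ < 1`). [cite: Balaban1988Convergent, (2.28) p.259 (bookkeeping)] -/
theorem hα0_theta13OfThm1CCM :
    ∀ (p : B12.RunParams) (n : ℕ), n ≤ p.K → Step.InInterval (theta13OfThm1CCM F N j ε₀ ε₂₉ B₃ B₃' a₀ a₁).γ n (gOfRecord₁₃ F N (theta13OfThm1CCM F N j ε₀ ε₂₉ B₃ B₃' a₀ a₁) p) → ∀ m, m ≤ n →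
      0 < (lfOfRecord₁₂ F N (theta13OfThm1CCM F N j ε₀ ε₂₉ B₃ B₃' a₀ a₁).toStage12Params).alpha0 (gOfRecord₁₃ F N (theta13OfThm1CCM F N j ε₀ ε₂₉ B₃ B₃' a₀ a₁) p m) :=
  fun p n _ hw m hm => alpha0_pos_of_lt_one _ (by rw [lfOfRecord₁₂_theta13OfThm1CCM]; norm_num [lfConstsOfFamily, lfConstsOfRecord₁₂]) (hw m hm).1
    ((hw m hm).2.trans_lt (by rw [theta13OfThm1CCM_γ]; norm_num))

/-- `0 ≤ B₃·cR·A₀` at `θ₁₅ᶜᶜᴹ`. [cite: Balaban1988Convergent, (2.28) p.259 (bookkeeping)] -/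
theorem mul_A0_nonneg_thm1CCM (hB : 0 ≤ B₃) (hB' : 0 ≤ B₃') (ha₀ : 0 ≤ a₀) (ha₁ : 0 ≤ a₁) :
    0 ≤ B₃ * (theta13OfThm1CCM F N j ε₀ ε₂₉ B₃ B₃' a₀ a₁).s2.cR * (theta13OfThm1CCM F N j ε₀ ε₂₉ B₃ B₃' a₀ a₁).ν.A₀ := by
  rw [theta13OfThm1CCM_cR, mul_one, theta13OfThm1CCM_A₀]
  exact mul_nonneg hB (A0OfThm1CC1_nonneg hB hB' ha₀ ha₁)

/-- The «C₀ sufficiently large» inequality of (2.34) at `θ₁₅ᶜᶜᴹ`: `B₃·cR·A₀ᶜᶜ¹ ≤ (1 − β)·C₀` (`≤ 1∕16 ≤ ¾`). [cite: Balaban1988Convergent, (2.28) p.259, (2.34) p.261] -/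
theorem mul_A0_le_C₀_thm1CCM (hB : 0 ≤ B₃) (hB' : 0 ≤ B₃') (ha₀ : 0 ≤ a₀) (ha₁ : 0 ≤ a₁) :
    B₃ * (theta13OfThm1CCM F N j ε₀ ε₂₉ B₃ B₃' a₀ a₁).s2.cR * (theta13OfThm1CCM F N j ε₀ ε₂₉ B₃ B₃' a₀ a₁).ν.A₀ ≤
      (1 - (theta13OfThm1CCM F N j ε₀ ε₂₉ B₃ B₃' a₀ a₁).s2.βc) * (lfOfRecord₁₂ F N (theta13OfThm1CCM F N j ε₀ ε₂₉ B₃ B₃' a₀ a₁).toStage12Params).C₀ := by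
  rw [theta13OfThm1CCM_cR, mul_one, theta13OfThm1CCM_A₀, theta13OfThm1CCM_βc, lfOfRecord₁₂_theta13OfThm1CCM]
  have h := mul_A0OfThm1CC1_le (L := F.L) hB hB' ha₀ ha₁
  norm_num [lfConstsOfFamily, lfConstsOfRecord₁₂]
  linarith

/-- **(hBα) AT `θ₁₅ᶜᶜᴹ`** (`bg_numerics_of_letters`: `p₀ = 1 ≤ q₀ = 2`, `B₃·A₀ᶜᶜ¹ ≤ ¾·C₀`, `g_m² ≤ e⁻¹`). [cite: Balaban1988Convergent, (2.4) p.255, (2.28) p.259, (2.34) p.261] -/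
theorem hBα_theta13OfThm1CCM (hB : 0 ≤ B₃) (hB' : 0 ≤ B₃') (ha₀ : 0 ≤ a₀) (ha₁ : 0 ≤ a₁) :
     ∀ (p : B12.RunParams) (n : ℕ), n ≤ p.K → Step.InInterval (theta13OfThm1CCM F N j ε₀ ε₂₉ B₃ B₃' a₀ a₁).γ n (gOfRecord₁₃ F N (theta13OfThm1CCM F N j ε₀ ε₂₉ B₃ B₃' a₀ a₁) p) → ∀ m, 1 ≤ m → m ≤ n →
      B₃ * ((theta13OfThm1CCM F N j ε₀ ε₂₉ B₃ B₃' a₀ a₁).s2.cR * epsOfRecord (theta13OfThm1CCM F N j ε₀ ε₂₉ B₃ B₃' a₀ a₁).ν (gOfRecord₁₃ F N (theta13OfThm1CCM F N j ε₀ ε₂₉ B₃ B₃' a₀ a₁) p) m) ≤ (1 - (theta13OfThm1CCM F N j ε₀ ε₂₉ B₃ B₃' a₀ a₁).s2.βc) * (lfOfRecord₁₂ F N (theta13OfThm1CCM F N j ε₀ ε₂₉ B₃ B₃' a₀ a₁).toStage12Params).alpha0 (gOfRecord₁₃ F N (theta13OfThm1CCM F N j ε₀ ε₂₉ B₃ B₃'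 a₀ a₁) p m) :=
  fun p n _ hw =>
    (theta13OfThm1CCM F N j ε₀ ε₂₉ B₃ B₃' a₀ a₁).bg_numerics_of_letters hpq_theta13OfThm1CCM
      (mul_A0_nonneg_thm1CCM hB hB' ha₀ ha₁) (mul_A0_le_C₀_thm1CCM hB hB' ha₀ ha₁) p n (hg_theta13OfThm1CCM p n ‹_› hw)

/-- **(C1) NESTED GRIDS AT `θ₁₅ᶜᶜᴹ`**: `R_m = L·t_m` along every windowed run (`L ≥ 2`, `r = 1`, `log g_m⁻² > 1` in `]0, ½]`). [cite: Balaban1988Convergent, (2.5) p.255, p.257] -/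
theorem hC1_theta13OfThm1CCM :
     ∀ (p : B12.RunParams) (n : ℕ), n ≤ p.K → Step.InInterval (theta13OfThm1CCM F N j ε₀ ε₂₉ B₃ B₃' a₀ a₁).γ n (gOfRecord₁₃ F N (theta13OfThm1CCM F N j ε₀ ε₂₉ B₃ B₃' a₀ a₁) p) → ∀ m, 1 ≤ m → m ≤ n →
      ∃ t : ℕ, 0 < t ∧ RkOfRecord (F.P p.K).L (theta13OfThm1CCM F N j ε₀ ε₂₉ B₃ B₃' a₀ a₁).ν.r (gOfRecord₁₃ F N (theta13OfThm1CCM F N j ε₀ ε₂₉ B₃ B₃' a₀ a₁) p m) = (F.P p.K).L * t := by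
  intro p n _ hw m _ hm
  have hL : 2 ≤ (F.P p.K).L := by show 2 ≤ F.L; have := F.hL11; omega
  exact exists_RkOfRecord_eq_mul hL (le_of_eq (theta13OfThm1CCM_r F N j ε₀ ε₂₉ B₃ B₃' a₀ a₁).symm)
    (one_lt_log_inv_sq_of_le_half (hw m hm).1 ((hw m hm).2.trans (theta13OfThm1CCM_γ F N j ε₀ ε₂₉ B₃ B₃' a₀ a₁).le))

/-- **(hcomp) AT `θ₁₅ᶜᶜᴹ` from the MONOTONICITY of the windowed history** (`cR·ε_m ≤ 2·cR·ε_{m+1}`; FILE 11c's profile lemma, `p₀ = 1`, `A₀ ≥ 0`, `g_{m+1} ≤ ½`).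
[cite: Balaban1988Convergent, (2.4) p.255, (2.7)–(2.8) pp.255–256; Balaban1987RG1, Thm 1 p.259] -/
theorem hcomp_theta13OfThm1CCM_of_monotone (hB : 0 ≤ B₃) (hB' : 0 ≤ B₃') (ha₀ : 0 ≤ a₀) (ha₁ : 0 ≤ a₁)
    (hmono : ∀ (p : B12.RunParams) (n : ℕ), n ≤ p.K → Step.InInterval (theta13OfThm1CCM F N j ε₀ ε₂₉ B₃ B₃' a₀ a₁).γ n (gOfRecord₁₃ F N (theta13OfThm1CCM F N j ε₀ ε₂₉ B₃ B₃' a₀ a₁) p) → ∀ m, m < n →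
      gOfRecord₁₃ F N (theta13OfThm1CCM F N j ε₀ ε₂₉ B₃ B₃' a₀ a₁) p m ≤ gOfRecord₁₃ F N (theta13OfThm1CCM F N j ε₀ ε₂₉ B₃ B₃' a₀ a₁) p (m + 1)) :
     ∀ (p : B12.RunParams) (n : ℕ), n ≤ p.K → Step.InInterval (theta13OfThm1CCM F N j ε₀ ε₂₉ B₃ B₃' a₀ a₁).γ n (gOfRecord₁₃ F N (theta13OfThm1CCM F N j ε₀ ε₂₉ B₃ B₃' a₀ a₁) p) → ∀ m, m < n →
      (theta13OfThm1CCM F N j ε₀ ε₂₉ B₃ B₃' a₀ a₁).s2.cR * epsOfRecord (theta13OfThm1CCM F N j ε₀ ε₂₉ B₃ B₃' a₀ a₁).ν (gOfRecord₁₃ F N (theta13OfThm1CCM F N j ε₀ ε₂₉ B₃ B₃' a₀ a₁) p) m ≤ 2 * ((theta13OfThm1CCM F N j ε₀ ε₂₉ B₃ B₃' a₀ a₁).s2.cR * epsOfRecord (theta13OfThm1CCM F N j ε₀ ε₂₉ B₃ B₃' a₀ a₁).ν (gOfRecord₁₃ F N (theta13OfThm1CCM F N j ε₀ ε₂₉ B₃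 B₃' a₀ a₁) p) (m + 1)) := by
  intro p n hn hw m hm
  rw [theta13OfThm1CCM_cR, one_mul, one_mul]
  have hγ := theta13OfThm1CCM_γ F N j ε₀ ε₂₉ B₃ B₃' a₀ a₁
  have h0 : 0 < gOfRecord₁₃ F N (theta13OfThm1CCM F N j ε₀ ε₂₉ B₃ B₃' a₀ a₁) p m := (hw m hm.le).1
  have hhalf : gOfRecord₁₃ F N (theta13OfThm1CCM F N j ε₀ ε₂₉ B₃ B₃' a₀ a₁) p (m + 1) ≤ 1 / 2 := (hw (m + 1) hm).2.trans hγ.le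
  exact epsOfRecord_le_two_mul_of_le _ (theta13OfThm1CCM_p₀ F N j ε₀ ε₂₉ B₃ B₃' a₀ a₁)
    (by rw [theta13OfThm1CCM_A₀]; exact A0OfThm1CC1_nonneg hB hB' ha₀ ha₁) h0 (hmono p n hn hw m hm) hhalf

/-- `0 ≤ B₃′·cR·A₀` at `θ₁₅ᶜᶜᴹ` (`cR = 1`). [cite: Balaban1988Convergent, (2.28) p.259 (bookkeeping)] -/
theorem gauge_mul_A0_nonneg_thm1CCM (hB : 0 ≤ B₃) (hB' : 0 ≤ B₃') (ha₀ : 0 ≤ a₀) (ha₁ : 0 ≤ a₁) :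
    0 ≤ B₃' * (theta13OfThm1CCM F N j ε₀ ε₂₉ B₃ B₃' a₀ a₁).s2.cR * (theta13OfThm1CCM F N j ε₀ ε₂₉ B₃ B₃' a₀ a₁).ν.A₀ := by
  rw [theta13OfThm1CCM_cR, mul_one, theta13OfThm1CCM_A₀]
  exact mul_nonneg hB' (A0OfThm1CC1_nonneg hB hB' ha₀ ha₁)

/-- **«C₀ sufficiently large» FOR THE I-FAMILY GAUGES at `θ₁₅ᶜᶜᴹ`**: `B₃′·cR·A₀ ≤ cB·C₀` (`cB = 6L + 1`, `C₀ = 1`, `cR = 1`; `B₃′·A₀ᶜᶜ¹ ≤ 1∕192`). [cite: Balaban1987RG1, (1.12) p.262; Balaban1988Convergent, (2.28) p.259] -/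
theorem gauge_mul_A0_le_cB_C₀_thm1CCM (hB : 0 ≤ B₃) (hB' : 0 ≤ B₃') (ha₀ : 0 ≤ a₀) (ha₁ : 0 ≤ a₁) :
    B₃' * (theta13OfThm1CCM F N j ε₀ ε₂₉ B₃ B₃' a₀ a₁).s2.cR * (theta13OfThm1CCM F N j ε₀ ε₂₉ B₃ B₃' a₀ a₁).ν.A₀ ≤ (theta13OfThm1CCM F N j ε₀ ε₂₉ B₃ B₃' a₀ a₁).s2.cB * (lfOfRecord₁₂ F N (theta13OfThm1CCM F N j ε₀ ε₂₉ B₃ B₃' a₀ a₁).toStage12Params).C₀ := by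
  rw [theta13OfThm1CCM_cR, mul_one, theta13OfThm1CCM_A₀, theta13OfThm1CCM_cB, lfOfRecord₁₂_theta13OfThm1CCM]
  have h1 : (1 : ℝ) ≤ F.L := by exact_mod_cast F.hL.2.le
  have h := gauge_mul_A0OfThm1CC1_le (L := F.L) F.hL.2.le hB hB' ha₀ ha₁
  norm_num [lfConstsOfFamily, lfConstsOfRecord₁₂]
  nlinarith

/-- **«C₀ sufficiently large» FOR THE MS-FAMILY GAUGES at `θ₁₅ᶜᶜᴹ`**: `B₃′·cR·A₀ ≤ B·C·M_r·C₀` (`B·C·M_r = 7`, `C₀ = 1`). [cite: Balaban1988Convergent, (2.38) p.261, (2.28) p.259] -/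
theorem gauge_mul_A0_le_BCM_C₀_thm1CCM (hB : 0 ≤ B₃) (hB' : 0 ≤ B₃') (ha₀ : 0 ≤ a₀) (ha₁ : 0 ≤ a₁) :
    B₃' * (theta13OfThm1CCM F N j ε₀ ε₂₉ B₃ B₃' a₀ a₁).s2.cR * (theta13OfThm1CCM F N j ε₀ ε₂₉ B₃ B₃' a₀ a₁).ν.A₀ ≤ (theta13OfThm1CCM F N j ε₀ ε₂₉ B₃ B₃' a₀ a₁).s2.B * (theta13OfThm1CCM F N j ε₀ ε₂₉ B₃ B₃' a₀ a₁).s2.C * (theta13OfThm1CCM F N j ε₀ ε₂₉ B₃ B₃' a₀ a₁).s2.Mr * (lfOfRecord₁₂ F N (theta13OfThm1CCM F N j ε₀ ε₂₉ B₃ B₃' a₀ a₁).toStage12Params).C₀ := by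
  rw [theta13OfThm1CCM_cR, mul_one, theta13OfThm1CCM_A₀, theta13OfThm1CCM_B, theta13OfThm1CCM_C, theta13OfThm1CCM_Mr, lfOfRecord₁₂_theta13OfThm1CCM]
  have h := gauge_mul_A0OfThm1CC1_le (L := F.L) F.hL.2.le hB hB' ha₀ ha₁
  norm_num [lfConstsOfFamily, lfConstsOfRecord₁₂]
  linarith

/-- **★ THE I-FAMILY RADIUS LETTER `htI` ALONG EVERY WINDOWED RUN AT `θ₁₅ᶜᶜᴹ`**: `B₃′·(cR·ε_m) ≤ cB·α₀(g_m)`, `1 ≤ m ≤ n` (FILE 14 `gaugeLetter_of_numerics`).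
[cite: Balaban1987RG1, (1.12) p.262; Balaban1988Convergent, (2.4) p.255, (2.28) p.259] -/
theorem htI_theta13OfThm1CCM (hB : 0 ≤ B₃) (hB' : 0 ≤ B₃') (ha₀ : 0 ≤ a₀) (ha₁ : 0 ≤ a₁) :
    ∀ (p : B12.RunParams) (n : ℕ), n ≤ p.K → Step.InInterval (theta13OfThm1CCM F N j ε₀ ε₂₉ B₃ B₃' a₀ a₁).γ n (gOfRecord₁₃ F N (theta13OfThm1CCM F N j ε₀ ε₂₉ B₃ B₃' a₀ a₁) p) → ∀ m, 1 ≤ m → m ≤ n →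
      B₃' * ((theta13OfThm1CCM F N j ε₀ ε₂₉ B₃ B₃' a₀ a₁).s2.cR * epsOfRecord (theta13OfThm1CCM F N j ε₀ ε₂₉ B₃ B₃' a₀ a₁).ν (gOfRecord₁₃ F N (theta13OfThm1CCM F N j ε₀ ε₂₉ B₃ B₃' a₀ a₁) p) m) ≤
        (theta13OfThm1CCM F N j ε₀ ε₂₉ B₃ B₃' a₀ a₁).s2.cB * (lfOfRecord₁₂ F N (theta13OfThm1CCM F N j ε₀ ε₂₉ B₃ B₃' a₀ a₁).toStage12Params).alpha0 (gOfRecord₁₃ F N (theta13OfThm1CCM F N j ε₀ ε₂₉ B₃ B₃' a₀ a₁) p m) :=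
  fun p n hn hw => gaugeLetter_of_numerics (lfOfRecord₁₂ F N (theta13OfThm1CCM F N j ε₀ ε₂₉ B₃ B₃' a₀ a₁).toStage12Params) (theta13OfThm1CCM F N j ε₀ ε₂₉ B₃ B₃' a₀ a₁).ν
    (fun m _ hm => hg_theta13OfThm1CCM p n hn hw m hm) hpq_theta13OfThm1CCM (gauge_mul_A0_nonneg_thm1CCM hB hB' ha₀ ha₁) (gauge_mul_A0_le_cB_C₀_thm1CCM hB hB' ha₀ ha₁)

/-- **★ THE MS-FAMILY RADIUS LETTER `htMS` ALONG EVERY WINDOWED RUN AT `θ₁₅ᶜᶜᴹ`**: `B₃′·(cR·ε_m) ≤ B·C·M_r·α₀(g_m)`, `1 ≤ m ≤ n`. [cite: Balaban1988Convergent, (2.38) p.261, (2.4) p.255, (2.28) p.259] -/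
theorem htMS_theta13OfThm1CCM (hB : 0 ≤ B₃) (hB' : 0 ≤ B₃') (ha₀ : 0 ≤ a₀) (ha₁ : 0 ≤ a₁) :
    ∀ (p : B12.RunParams) (n : ℕ), n ≤ p.K → Step.InInterval (theta13OfThm1CCM F N j ε₀ ε₂₉ B₃ B₃' a₀ a₁).γ n (gOfRecord₁₃ F N (theta13OfThm1CCM F N j ε₀ ε₂₉ B₃ B₃' a₀ a₁) p) → ∀ m, 1 ≤ m → m ≤ n →
      B₃' * ((theta13OfThm1CCM F N j ε₀ ε₂₉ B₃ B₃' a₀ a₁).s2.cR * epsOfRecord (theta13OfThm1CCM F N j ε₀ ε₂₉ B₃ B₃' a₀ a₁).ν (gOfRecord₁₃ F N (theta13OfThm1CCM F N j ε₀ ε₂₉ B₃ B₃' a₀ a₁) p) m) ≤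
        (theta13OfThm1CCM F N j ε₀ ε₂₉ B₃ B₃' a₀ a₁).s2.B * (theta13OfThm1CCM F N j ε₀ ε₂₉ B₃ B₃' a₀ a₁).s2.C * (theta13OfThm1CCM F N j ε₀ ε₂₉ B₃ B₃' a₀ a₁).s2.Mr * (lfOfRecord₁₂ F N (theta13OfThm1CCM F N j ε₀ ε₂₉ B₃ B₃' a₀ a₁).toStage12Params).alpha0 (gOfRecord₁₃ F N (theta13OfThm1CCM F N j ε₀ ε₂₉ B₃ B₃' a₀ a₁) p m) :=
  fun p n hn hw => gaugeLetter_of_numerics (lfOfRecord₁₂ F N (theta13OfThm1CCM F N j ε₀ ε₂₉ B₃ B₃' a₀ a₁).toStage12Params) (theta13OfThm1CCM F N j ε₀ ε₂₉ B₃ B₃' a₀ a₁).ν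
    (fun m _ hm => hg_theta13OfThm1CCM p n hn hw m hm) hpq_theta13OfThm1CCM (gauge_mul_A0_nonneg_thm1CCM hB hB' ha₀ ha₁) (gauge_mul_A0_le_BCM_C₀_thm1CCM hB hB' ha₀ ha₁)

end Faces

/-! ## §4. The pins, ★ the collar letter, ★ no wrapping under `j + 1 ≤ F.m`, ★ and the certificate that the top [I]-cube wraps when `F.m ≤ j` (LOCATED (δ)) -/

section Pins

variable (F : T4Family) (N : ℕ) [NeZero N] (j : ℕ) (ε₀ ε₂₉ B₃ B₃' a₀ a₁ : ℝ)

/-- `0 < θ₁₅ᶜᶜᴹ.τ9.M` (`L ≥ 13`). [cite: Balaban1989LargeFieldI, (2.1) p.182 (bookkeeping)] -/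
theorem τ9_M_pos_theta13OfThm1CCM : 0 < (theta13OfThm1CCM F N j ε₀ ε₂₉ B₃ B₃' a₀ a₁).τ9.M := by
  rw [theta13OfThm1CCM_τ9_M]; exact Nat.pow_pos (by have := F.hL11; omega)

/-- `0 < θ₁₅ᶜᶜᴹ.ν.M₁` (`L ≥ 13`) — the binder `0 < ν.M₁` of the step facts. [cite: Balaban1985RegularSpaces, (1.3)–(1.6) p.77 (bookkeeping)] -/
theorem M₁_pos_theta13OfThm1CCM : 0 < (theta13OfThm1CCM F N j ε₀ ε₂₉ B₃ B₃' a₀ a₁).ν.M₁ := by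
  rw [theta13OfThm1CCM_M₁]; exact Nat.pow_pos (by have := F.hL11; omega)

/-- **THE PIN `hM`**: the cube letter is a power of `L` (`⟨j, rfl⟩`). [cite: Balaban1988Convergent, (2.18) p.257, p.245 (bookkeeping)] -/
theorem hM_theta13OfThm1CCM : ∃ a : ℕ, (theta13OfThm1CCM F N j ε₀ ε₂₉ B₃ B₃' a₀ a₁).τ9.M = F.L ^ a := ⟨j, rfl⟩

/-- **THE PIN `hM₁`**: `M₁ ∣ M` (`L^j ∣ L^j`). [cite: Balaban1988Convergent, (2.13) p.256, (2.18) p.257 (bookkeeping)] -/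
theorem hM₁_theta13OfThm1CCM : (theta13OfThm1CCM F N j ε₀ ε₂₉ B₃ B₃' a₀ a₁).ν.M₁ ∣ (theta13OfThm1CCM F N j ε₀ ε₂₉ B₃ B₃' a₀ a₁).τ9.M := dvd_refl _

/-- **THE COLLAR ARITHMETIC**: `(11·4 + 3·L)·L ≤ L^j` for `9 ≤ L` and `3 ≤ j` (`44 + 3L ≤ L²` since `L(L − 3) ≥ 54 ≥ 44`). [folklore] -/
private theorem collar_le_pow {L j : ℕ} (hL : 9 ≤ L) (hj : 3 ≤ j) : (11 * 4 + 3 * L) * L ≤ L ^ j := by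
  have h2 : 44 + 3 * L ≤ L * L := by nlinarith
  have h3 : (11 * 4 + 3 * L) * L ≤ L ^ 3 := by
    calc (11 * 4 + 3 * L) * L = (44 + 3 * L) * L := by ring
      _ ≤ (L * L) * L := Nat.mul_le_mul_right L h2
      _ = L ^ 3 := by ring
  exact h3.trans (Nat.pow_le_pow_right (by omega) hj)

variable {j} in
/-- **★ THE COLLAR LETTER OF THE R-ROAD AT `θ₁₅ᶜᶜᴹ`**: dag-n07-e's floor `(11·4 + 3·L)·L ≤ ν.M₁` (the binder `c ≤ ν.M₁` of `Gauge152OfClassTopStepR ∕ Gauge9RegSepTopStepR` at the `c` of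
`gauge152R_of_prop6`) holds for every `j ≥ 3` (`L ≥ 13`). [cite: Balaban1985RegularSpaces, Prop. 6 p.99, (1.130) p.99, (1.3)–(1.6) p.77; Balaban1985Variational, (144) p.300 (bookkeeping)] -/
theorem collar_le_M₁_theta13OfThm1CCM (hj : 3 ≤ j) : (11 * 4 + 3 * F.L) * F.L ≤ (theta13OfThm1CCM F N j ε₀ ε₂₉ B₃ B₃' a₀ a₁).ν.M₁ := by
  rw [theta13OfThm1CCM_M₁]; exact collar_le_pow (by have := F.hL11; omega) hj

variable {j} in
/-- The collar letter in the `Setup.Params` letters of every torus of the family (`(F.P K).d = 4`, `(F.P K).L = F.L`). [cite: Balaban1985RegularSpaces, Prop. 6 p.99 (bookkeeping)] -/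
theorem collar_le_M₁_theta13OfThm1CCM' (hj : 3 ≤ j) (K : ℕ) :
    (11 * (F.P K).d + 3 * (F.P K).L) * (F.P K).L ≤ (theta13OfThm1CCM F N j ε₀ ε₂₉ B₃ B₃' a₀ a₁).ν.M₁ :=
  collar_le_M₁_theta13OfThm1CCM F N ε₀ ε₂₉ B₃ B₃' a₀ a₁ hj

variable {j} in
/-- **★ NO WRAPPING AT `θ₁₅ᶜᶜᴹ` UNDER `j + 1 ≤ F.m`**: the cubes of record of side `L^{n'}·M = L^{n'+j}` (`n' ≤ K + 1`) are shorter than the torus (`2L^{m+K}` sites per direction)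
— FILE 21 §2's binder `hsN`. [cite: Balaban1987RG1, (0.1) p.251; Balaban1988Convergent, p.257 (bookkeeping)] -/
theorem hsN_theta13OfThm1CCM (hjm : j + 1 ≤ F.m) :
     ∀ (p : B12.RunParams) (n : ℕ), n ≤ p.K → ∀ n', 1 ≤ n' → n' ≤ n + 1 →
      ((B14.Eq213MaximalDomains.side (F.P p.K).L (theta13OfThm1CCM F N j ε₀ ε₂₉ B₃ B₃' a₀ a₁).τ9.M n' : ℕ) : ℤ) < (F.P p.K).sitesPerDir 0 := by
  intro p n hn n' _ hn'
  rw [theta13OfThm1CCM_τ9_M]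
  have hL : 0 < F.L := by have := F.hL11; omega
  have hnat : B14.Eq213MaximalDomains.side (F.P p.K).L (F.L ^ j) n' < (F.P p.K).sitesPerDir 0 := by
    show F.L ^ n' * F.L ^ j < 2 * F.L ^ (F.m + p.K - 0)
    rw [Nat.sub_zero, ← pow_add]
    have h1 : F.L ^ (n' + j) ≤ F.L ^ (F.m + p.K) := Nat.pow_le_pow_right hL (by omega)
    have h0 : 0 < F.L ^ (F.m + p.K) := Nat.pow_pos hL
    omega
  exact_mod_cast hnat

variable {j} in
/-- **★ THE CERTIFICATE OF plan g75's LOCATED (δ)**: if `F.m ≤ j`, then on EVERY run `p` the top [I]-cube of the row body (level `n' = p.K + 1`, side `L^{K+1}·M = L^{K+1+j} ≥ 2·L^{m+K}`) is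
at least as long as the torus — the non-wrapping binder `hsN` of FILE 21 §2 is FALSE at this member.  With the collar floor `j ≥ 3` the R-road therefore has NO witness on this member
for families with `F.m ≤ 3` (torus of side `≤ 2L³` unit sites, shorter than one collared cube); `T4Family.hm` only gives `1 ≤ m`.  Displayed for the director's ruling; every closer on
this member carries `j + 1 ≤ F.m`. [cite: Balaban1987RG1, (0.1) p.251 («m is a positive integer»); Balaban1988Convergent, p.257, (2.38) p.261 (bookkeeping certificate)] -/
theorem exists_wrap_theta13OfThm1CCM_of_le (hmj : F.m ≤ j) (p : B12.RunParams) :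
    ∃ n n', n ≤ p.K ∧ 1 ≤ n' ∧ n' ≤ n + 1 ∧
      ¬ ((B14.Eq213MaximalDomains.side (F.P p.K).L (theta13OfThm1CCM F N j ε₀ ε₂₉ B₃ B₃' a₀ a₁).τ9.M n' : ℕ) : ℤ) < (F.P p.K).sitesPerDir 0 := by
  refine ⟨p.K, p.K + 1, le_rfl, by omega, le_rfl, ?_⟩
  rw [theta13OfThm1CCM_τ9_M, not_lt]
  have hL : 2 ≤ F.L := by have := F.hL11; omega
  have hnat : (F.P p.K).sitesPerDir 0 ≤ B14.Eq213MaximalDomains.side (F.P p.K).L (F.L ^ j) (p.K + 1) := by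
    show 2 * F.L ^ (F.m + p.K - 0) ≤ F.L ^ (p.K + 1) * F.L ^ j
    rw [Nat.sub_zero, ← pow_add]
    have h1 : F.L ^ (F.m + p.K) ≤ F.L ^ (p.K + j) := Nat.pow_le_pow_right (by omega) (by omega)
    calc 2 * F.L ^ (F.m + p.K) ≤ F.L * F.L ^ (p.K + j) := Nat.mul_le_mul hL h1
      _ = F.L ^ (p.K + 1 + j) := by ring
  exact_mod_cast hnat

variable {j} in
/-- … so the universally quantified non-wrapping binder fails outright when `F.m ≤ j`. [cite: Balaban1987RG1, (0.1) p.251; Balaban1988Convergent, p.257 (bookkeeping certificate)] -/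
theorem not_hsN_theta13OfThm1CCM_of_le (hmj : F.m ≤ j) (p : B12.RunParams) :
    ¬ ∀ n, n ≤ p.K → ∀ n', 1 ≤ n' → n' ≤ n + 1 →
      ((B14.Eq213MaximalDomains.side (F.P p.K).L (theta13OfThm1CCM F N j ε₀ ε₂₉ B₃ B₃' a₀ a₁).τ9.M n' : ℕ) : ℤ) < (F.P p.K).sitesPerDir 0 := by
  intro h
  obtain ⟨n, n', hn, h1, hn', hw⟩ := exists_wrap_theta13OfThm1CCM_of_le F N ε₀ ε₂₉ B₃ B₃' a₀ a₁ hmj p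
  exact hw (h n hn n' h1 hn')

/-- **THE NON-WRAPPING BINDER AT `θ₁₅ᶜᶜᴹ` IS EQUIVALENT TO `j + 1 ≤ F.m`** (both directions above; runs `p : B12.RunParams` are inhabited at every `K`). [cite: Balaban1987RG1, (0.1) p.251; Balaban1988Convergent, p.257 (bookkeeping certificate)] -/
theorem hsN_theta13OfThm1CCM_iff (p : B12.RunParams) :
    (∀ n, n ≤ p.K → ∀ n', 1 ≤ n' → n' ≤ n + 1 →
      ((B14.Eq213MaximalDomains.side (F.P p.K).L (theta13OfThm1CCM F N j ε₀ ε₂₉ B₃ B₃' a₀ a₁).τ9.M n' : ℕ) : ℤ) < (F.P p.K).sitesPerDir 0) ↔ j + 1 ≤ F.m := by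
  refine ⟨fun h => ?_, fun hjm => hsN_theta13OfThm1CCM F N ε₀ ε₂₉ B₃ B₃' a₀ a₁ hjm p⟩
  by_contra hlt
  exact not_hsN_theta13OfThm1CCM_of_le F N ε₀ ε₂₉ B₃ B₃' a₀ a₁ (by omega) p h

end Pins

/-! ## §5. The two history clauses at `θ₁₅ᶜᶜᴹ` from the β-box on `]0, ½]` (13e ∕ 14d are θ-generic) -/

section History

variable {F : T4Family} {N : ℕ} [NeZero N] {j : ℕ} {ε₀ ε₂₉ B₃ B₃' a₀ a₁ : ℝ}

/-- **(hmono) AT `θ₁₅ᶜᶜᴹ` from `BetaLowerH b ½ β₁₃(θ₁₅ᶜᶜᴹ)`, `0 ≤ b`** (`γ = ½`). [cite: Balaban1987RG1, (0.20) p.256, §1 p.264; Balaban1988Convergent, (2.6) p.255] -/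
theorem hmono_theta13OfThm1CCM_of_betaLowerH {b : ℝ} (hb : 0 ≤ b) (hlow : BetaLowerH b (1 / 2) (betaOfRecord₁₃ F N (theta13OfThm1CCM F N j ε₀ ε₂₉ B₃ B₃' a₀ a₁))) :
    ∀ (p : B12.RunParams) (n : ℕ), n ≤ p.K → Step.InInterval (theta13OfThm1CCM F N j ε₀ ε₂₉ B₃ B₃' a₀ a₁).γ n (gOfRecord₁₃ F N (theta13OfThm1CCM F N j ε₀ ε₂₉ B₃ B₃' a₀ a₁) p) → ∀ m, m < n →
      gOfRecord₁₃ F N (theta13OfThm1CCM F N j ε₀ ε₂₉ B₃ B₃' a₀ a₁) p m ≤ gOfRecord₁₃ F N (theta13OfThm1CCM F N j ε₀ ε₂₉ B₃ B₃' a₀ a₁) p (m + 1) :=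
  (theta13OfThm1CCM F N j ε₀ ε₂₉ B₃ B₃' a₀ a₁).hmono_of_betaLowerH hb ((theta13OfThm1CCM_γ F N j ε₀ ε₂₉ B₃ B₃' a₀ a₁).symm ▸ hlow)

/-- **(hcomp) AT `θ₁₅ᶜᶜᴹ` FROM THE β-SIGN LEAF**: `cR·ε_m ≤ 2·cR·ε_{m+1}` along every windowed run. [cite: Balaban1988Convergent, (2.4) p.255, (2.6)–(2.8) pp.255–256; Balaban1987RG1, (0.20) p.256, §1 p.264] -/
theorem hcomp_theta13OfThm1CCM_of_betaLowerH (hB : 0 ≤ B₃) (hB' : 0 ≤ B₃') (ha₀ : 0 ≤ a₀) (ha₁ : 0 ≤ a₁)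
    {b : ℝ} (hb : 0 ≤ b) (hlow : BetaLowerH b (1 / 2) (betaOfRecord₁₃ F N (theta13OfThm1CCM F N j ε₀ ε₂₉ B₃ B₃' a₀ a₁))) :
    ∀ (p : B12.RunParams) (n : ℕ), n ≤ p.K → Step.InInterval (theta13OfThm1CCM F N j ε₀ ε₂₉ B₃ B₃' a₀ a₁).γ n (gOfRecord₁₃ F N (theta13OfThm1CCM F N j ε₀ ε₂₉ B₃ B₃' a₀ a₁) p) → ∀ m, m < n →
      (theta13OfThm1CCM F N j ε₀ ε₂₉ B₃ B₃' a₀ a₁).s2.cR * epsOfRecord (theta13OfThm1CCM F N j ε₀ ε₂₉ B₃ B₃' a₀ a₁).ν (gOfRecord₁₃ F N (theta13OfThm1CCM F N j ε₀ ε₂₉ B₃ B₃' a₀ a₁) p) m ≤ 2 * ((theta13OfThm1CCM F N j ε₀ ε₂₉ B₃ B₃' a₀ a₁).s2.cR * epsOfRecord (theta13OfThm1CCM F N j ε₀ ε₂₉ B₃ B₃' a₀ a₁).ν (gOfRecord₁₃ F N (theta13OfThm1CCM F N j ε₀ ε₂₉ B₃ B₃' a₀ a₁) p) (m + 1)) 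:=
  hcomp_theta13OfThm1CCM_of_monotone hB hB' ha₀ ha₁ (hmono_theta13OfThm1CCM_of_betaLowerH hb hlow)

/-- **★★ THE REVERSE COMPARABILITY CLAUSE AT `θ₁₅ᶜᶜᴹ`** (`γ = ½`, `cR = 1`, `A₀ = A₀ᶜᶜ¹ ≥ 0`): `cR·ε_{m+1} ≤ 2·(cR·ε_m)` along every windowed run, from `BetaLowerH b ½ β₁₃(θ₁₅ᶜᶜᴹ)` (`0 ≤ b`)
and `BetaUpperH β′ ½ β₁₃(θ₁₅ᶜᶜᴹ)` with `β′ ≤ 3`. CONDITIONAL on the displayed β-box; nothing of Bałaban asserted. [cite: Balaban1988Convergent, (2.4) p.255, (2.6)–(2.8) pp.255–256; Balaban1987RG1, (0.20) p.256, §1 p.264; Balaban1985Variational, Thm 1 p.279] -/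
theorem hcompRev_theta13OfThm1CCM_of_betaBox (hB : 0 ≤ B₃) (hB' : 0 ≤ B₃') (ha₀ : 0 ≤ a₀) (ha₁ : 0 ≤ a₁)
    {b β' : ℝ} (hb : 0 ≤ b) (hlow : BetaLowerH b (1 / 2) (betaOfRecord₁₃ F N (theta13OfThm1CCM F N j ε₀ ε₂₉ B₃ B₃' a₀ a₁)))
    (hup : BetaUpperH β' (1 / 2) (betaOfRecord₁₃ F N (theta13OfThm1CCM F N j ε₀ ε₂₉ B₃ B₃' a₀ a₁))) (hβ' : β' ≤ 3) :
    ∀ (p : B12.RunParams) (n : ℕ), n ≤ p.K → Step.InInterval (theta13OfThm1CCM F N j ε₀ ε₂₉ B₃ B₃' a₀ a₁).γ n (gOfRecord₁₃ F N (theta13OfThm1CCM F N j ε₀ ε₂₉ B₃ B₃' a₀ a₁) p) → ∀ m, m < n →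
      (theta13OfThm1CCM F N j ε₀ ε₂₉ B₃ B₃' a₀ a₁).s2.cR * epsOfRecord (theta13OfThm1CCM F N j ε₀ ε₂₉ B₃ B₃' a₀ a₁).ν (gOfRecord₁₃ F N (theta13OfThm1CCM F N j ε₀ ε₂₉ B₃ B₃' a₀ a₁) p) (m + 1) ≤ 2 * ((theta13OfThm1CCM F N j ε₀ ε₂₉ B₃ B₃' a₀ a₁).s2.cR * epsOfRecord (theta13OfThm1CCM F N j ε₀ ε₂₉ B₃ B₃' a₀ a₁).ν (gOfRecord₁₃ F N (theta13OfThm1CCM F N j ε₀ ε₂₉ B₃ B₃' a₀ a₁) p) m) :=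
  (theta13OfThm1CCM F N j ε₀ ε₂₉ B₃ B₃' a₀ a₁).hcompRev_of_betaBox (by rw [theta13OfThm1CCM_A₀]; exact A0OfThm1CC1_nonneg hB hB' ha₀ ha₁) (by rw [theta13OfThm1CCM_γ]; norm_num)
    (by rw [theta13OfThm1CCM_cR]; norm_num) hb ((theta13OfThm1CCM_γ F N j ε₀ ε₂₉ B₃ B₃' a₀ a₁).symm ▸ hlow) ((theta13OfThm1CCM_γ F N j ε₀ ε₂₉ B₃ B₃' a₀ a₁).symm ▸ hup)
    (by rw [theta13OfThm1CCM_γ]; linarith)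

/-- **★★ THE TWO-SIDED COMPARABILITY PAIR AT `θ₁₅ᶜᶜᴹ`** from the β-box `b ≤ β₁₃ ≤ β′` on `]0, ½]` with `0 ≤ b`, `β′ ≤ 3`. CONDITIONAL; nothing of Bałaban asserted.
[cite: Balaban1988Convergent, (2.6)–(2.8) pp.255–256; Balaban1987RG1, (0.20) p.256, §1 p.264; Balaban1985Variational, Thm 1 p.279] -/
theorem hcompBoth_theta13OfThm1CCM_of_betaBox (hB : 0 ≤ B₃) (hB' : 0 ≤ B₃') (ha₀ : 0 ≤ a₀) (ha₁ : 0 ≤ a₁)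
    {b β' : ℝ} (hb : 0 ≤ b) (hlow : BetaLowerH b (1 / 2) (betaOfRecord₁₃ F N (theta13OfThm1CCM F N j ε₀ ε₂₉ B₃ B₃' a₀ a₁)))
    (hup : BetaUpperH β' (1 / 2) (betaOfRecord₁₃ F N (theta13OfThm1CCM F N j ε₀ ε₂₉ B₃ B₃' a₀ a₁))) (hβ' : β' ≤ 3) :
    (∀ (p : B12.RunParams) (n : ℕ), n ≤ p.K → Step.InInterval (theta13OfThm1CCM F N j ε₀ ε₂₉ B₃ B₃' a₀ a₁).γ n (gOfRecord₁₃ F N (theta13OfThm1CCM F N j ε₀ ε₂₉ B₃ B₃' a₀ a₁) p) → ∀ m, m < n →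
      (theta13OfThm1CCM F N j ε₀ ε₂₉ B₃ B₃' a₀ a₁).s2.cR * epsOfRecord (theta13OfThm1CCM F N j ε₀ ε₂₉ B₃ B₃' a₀ a₁).ν (gOfRecord₁₃ F N (theta13OfThm1CCM F N j ε₀ ε₂₉ B₃ B₃' a₀ a₁) p) m ≤ 2 * ((theta13OfThm1CCM F N j ε₀ ε₂₉ B₃ B₃' a₀ a₁).s2.cR * epsOfRecord (theta13OfThm1CCM F N j ε₀ ε₂₉ B₃ B₃' a₀ a₁).ν (gOfRecord₁₃ F N (theta13OfThm1CCM F N j ε₀ ε₂₉ B₃ B₃' a₀ a₁) p) (m + 1))) ∧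
    (∀ (p : B12.RunParams) (n : ℕ), n ≤ p.K → Step.InInterval (theta13OfThm1CCM F N j ε₀ ε₂₉ B₃ B₃' a₀ a₁).γ n (gOfRecord₁₃ F N (theta13OfThm1CCM F N j ε₀ ε₂₉ B₃ B₃' a₀ a₁) p) → ∀ m, m < n →
      (theta13OfThm1CCM F N j ε₀ ε₂₉ B₃ B₃' a₀ a₁).s2.cR * epsOfRecord (theta13OfThm1CCM F N j ε₀ ε₂₉ B₃ B₃' a₀ a₁).ν (gOfRecord₁₃ F N (theta13OfThm1CCM F N j ε₀ ε₂₉ B₃ B₃' a₀ a₁) p) (m + 1) ≤ 2 * ((theta13OfThm1CCM F N j ε₀ ε₂₉ B₃ B₃' a₀ a₁).s2.cR * epsOfRecord (theta13OfThm1CCM F N j ε₀ ε₂₉ B₃ B₃' a₀ a₁).ν (gOfRecord₁₃ F N (theta13OfThm1CCM F N j ε₀ ε₂₉ B₃ B₃' a₀ a₁) p) m)) :=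
  ⟨hcomp_theta13OfThm1CCM_of_betaLowerH hB hB' ha₀ ha₁ hb hlow, hcompRev_theta13OfThm1CCM_of_betaBox hB hB' ha₀ ha₁ hb hlow hup hβ'⟩

end History

end Literature.MathematicalPhysics.QuantumFieldTheory.Balaban1983to89.Node00

end
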